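import Literature.NumberTheory.Automorphic.BrandtModuleRamifiedLocal
import HarnessLib

/-!
# Residually ramified primes II: sub-ideals of `p`-power index are unique; the fibre count `1`

Nineteenth layer of the proof files for the named fact `brandtMatrix_comm` of `BrandtModule.lean`
(Vignéras, LNM 800, III §5 ex. 5.8 (c); Eichler 1973, II §6 Thm. 2). Continuing
`BrandtModuleRamifiedLocal.lean` (`O` residually ramified at `p`, data `IsRamifiedData O 𝔓 p`,
uniformizer `π`), in a division quaternion algebra over `ℚ`:

* `IsRamifiedData.units_smul_localAt_eq_pow_smul` — **the principal right ideals of `O_(p)` are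
  the `π^m O_(p)`**: a unit `z ∈ O_(p)` with `v_p(nrd z) = m` has `z O_(p) = π^m O_(p)`
  (induction on `m`: off `𝔓_(p)` the valuation vanishes, inside `𝔓_(p) = π O_(p)` divide by `π`);
* `IsRamifiedData.localAt_subideal`, `subsingleton_subideal` — an invertible `J ∈ Sub(I, p^m)`
  has `J_(p) = α π^m O_(p)` (`I_(p) = α O_(p)`), so `Sub(I, p^m)` has at most one element;
* `IsRamifiedData.exists_subideal_ge`, `card_fibre_eq_one` — it has one, containing any given
  `K ∈ Sub(I, p^{m} p)`; hence every fibre of the Hecke recursion has exactly one element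
  (`c = 0`: `B(p^{a+1}) B(p) = B(p^{a+2})` at a residually ramified prime).

## References

* M.-F. Vignéras, LNM 800 (1980), Ch. II §1 Thm. 1.1 ("les idéaux … sont les `Oπ^n`"),
  Ch. III §5 ex. 5.8 (c) [VignerasLNM800].
* J. Voight, *Quaternion Algebras* (2021), §13.3, §26.4 [Voight2021].
-/

noncomputable section

open scoped Pointwise

universe u

namespace Literature.NumberTheory.Automorphic

variable {B : Type u} [Ring B] [Algebra ℚ B] [IsQuaternionAlgebra ℚ B] {O P : Submodule ℤ B} {p : ℕ}

/-! ### Norms of powers, powers in `O_(p)` -/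

/-- `nrd 1 = 1`. [folklore] -/
theorem reducedNorm_one' : reducedNorm ℚ B (1 : B) = 1 := by
  have h := reducedNorm_mul_holds ℚ B (1 : B) 1
  rw [mul_one] at h
  have h0 : reducedNorm ℚ B (1 : B) ≠ 0 := (isUnit_iff_reducedNorm_ne_zero_holds ℚ B (1 : B)).mp isUnit_one
  have : reducedNorm ℚ B (1 : B) * (reducedNorm ℚ B (1 : B) - 1) = 0 := by rw [mul_sub, mul_one, ← h, sub_self]
  rcases mul_eq_zero.mp this with h1 | h1
  · exact absurd h1 h0
  · exact sub_eq_zero.mp h1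

/-- `nrd (x^n) = (nrd x)^n`. [folklore] -/
theorem reducedNorm_pow' (x : B) (n : ℕ) : reducedNorm ℚ B (x ^ n) = reducedNorm ℚ B x ^ n := by
  induction n with
  | zero => rw [pow_zero, pow_zero, reducedNorm_one']
  | succ n ih => rw [pow_succ, reducedNorm_mul_holds ℚ B, ih, pow_succ]

omit [Algebra ℚ B] [IsQuaternionAlgebra ℚ B] in
/-- Powers of an element of `O_(p)` lie in `O_(p)`. [folklore] -/
theorem IsZOrder.pow_mem_localAt (hO : IsZOrder O) {x : B} (hx : x ∈ localAt p O) (n : ℕ) : x ^ n ∈ localAt p O := by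
  induction n with
  | zero => rw [pow_zero]; exact le_localAt p O hO.one_mem
  | succ n ih => rw [pow_succ]; exact mul_mem_localAt hO.mul_mem p ih hx

omit [Algebra ℚ B] [IsQuaternionAlgebra ℚ B] in
/-- `z O_(p) ⊆ O_(p)` for `z ∈ O_(p)`. [folklore] -/
theorem IsZOrder.units_smul_localAt_le (hO : IsZOrder O) {z : Bˣ} (hz : (z : B) ∈ localAt p O) :
    z • localAt p O ≤ localAt p O := fun x hx => by
  obtain ⟨y, hy, rfl⟩ := (Submodule.mem_smul_pointwise_iff_exists _ _ _).mp hx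
  rw [Units.smul_def, smul_eq_mul]
  exact mul_mem_localAt hO.mul_mem p hz hy

namespace IsRamifiedData

variable (hO : IsZOrder O) (hP : IsRamifiedData O P p) (hp : p.Prime) [Fact p.Prime]
  {π : Bˣ} (hπ : localAt p P = π • localAt p O) (hvπ : padicValRat p (reducedNorm ℚ B π) = 1)

include hO hP hp hπ hvπ in
/-- **The principal right ideals of `O_(p)` are the `π^m O_(p)`**: a unit `z ∈ O_(p)` with
`v_p(nrd z) = m` has `z O_(p) = π^m O_(p)`. [cite: VignerasLNM800, Ch. II §1 Thm. 1.1] -/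
theorem units_smul_localAt_eq_pow_smul :
    ∀ (m : ℕ) (z : Bˣ), (z : B) ∈ localAt p O → padicValRat p (reducedNorm ℚ B z) = m →
      z • localAt p O = (π ^ m) • localAt p O := by
  have hπO : (π : B) ∈ localAt p O := by
    have : (π : B) ∈ π • localAt p O := (Submodule.mem_smul_pointwise_iff_exists _ _ _).mpr
      ⟨1, le_localAt p O hO.one_mem, by rw [Units.smul_def, smul_eq_mul, mul_one]⟩
    rw [← hπ] at this
    exact localAt_mono p hP.le this
  have hπ0 : reducedNorm ℚ B (π : B) ≠ 0 := (isUnit_iff_reducedNorm_ne_zero_holds ℚ B (π : B)).mp π.isUnit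
  intro m
  induction m with
  | zero =>
    intro z hz hv
    obtain ⟨k, hk, hidx⟩ := exists_relIndex_units_smul_localAt_eq_pow hO z hz
    have hk0 : k = 0 := by rw [hv] at hk; exact_mod_cast hk.symm
    rw [hk0, mul_zero, pow_zero] at hidx
    rw [pow_zero, one_smul]
    exact le_antisymm (hO.units_smul_localAt_le hz)
      (fun x hx => AddSubgroup.relIndex_eq_one.mp hidx (show x ∈ (localAt p O).toAddSubgroup from hx))
  | succ m ih =>
    intro z hz hv
    have hz0 : reducedNorm ℚ B (z : B) ≠ 0 := (isUnit_iff_reducedNorm_ne_zero_holds ℚ B (z : B)).mp z.isUnit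
    have hzP : (z : B) ∈ localAt p P := by
      by_contra h
      have := hP.padicValRat_reducedNorm_eq_zero hO hp hz h
      rw [hv] at this
      exact absurd this (by exact_mod_cast Nat.succ_ne_zero m)
    rw [hπ] at hzP
    have hz₁ : ((π⁻¹ * z : Bˣ) : B) ∈ localAt p O := by
      rw [Units.val_mul, ← mem_units_smul_iff_mul_mem]; exact hzP
    have hz₁0 : reducedNorm ℚ B ((π⁻¹ * z : Bˣ) : B) ≠ 0 :=
      (isUnit_iff_reducedNorm_ne_zero_holds ℚ B _).mp (π⁻¹ * z).isUnit
    have hv₁ : padicValRat p (reducedNorm ℚ B ((π⁻¹ * z : Bˣ) : B)) = m := by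
      have hmul : reducedNorm ℚ B (z : B) = reducedNorm ℚ B (π : B) * reducedNorm ℚ B (((π⁻¹ : Bˣ) : B) * z) := by
        rw [← reducedNorm_mul_holds ℚ B, ← mul_assoc, Units.mul_inv, one_mul]
      have hz₁0' : reducedNorm ℚ B (((π⁻¹ : Bˣ) : B) * z) ≠ 0 := by rw [← Units.val_mul]; exact hz₁0
      have h := hv
      rw [hmul, padicValRat.mul hπ0 hz₁0', hvπ] at h
      rw [Units.val_mul]
      push_cast at h
      linarith
    have hih := ih _ hz₁ hv₁
    calc z • localAt p O = (π * (π⁻¹ * z)) • localAt p O := by rw [mul_inv_cancel_left]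
      _ = π • ((π⁻¹ * z) • localAt p O) := mul_smul _ _ _
      _ = π • ((π ^ m) • localAt p O) := by rw [hih]
      _ = (π ^ (m + 1)) • localAt p O := by rw [← mul_smul, ← pow_succ']

variable (hdiv : ∀ x : B, x ≠ 0 → IsUnit x) {I : Submodule ℤ B} (hI : IsInvertibleRightIdeal O I)
  {α : Bˣ} (hα : localAt p I = α • localAt p O)

include hO hP hp hπ hvπ hdiv hα in
/-- **`J_(p) = α π^m O_(p)`** for an invertible `J ∈ Sub(I, n)`, `n = p^m`, `I_(p) = α O_(p)`. [cite: VignerasLNM800, Ch. II §1 Thm. 1.1; Voight2021, §26.4] -/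
theorem localAt_subideal {n : ℕ} (J : Subideal O I n) {m : ℕ} (hn : n = p ^ m) :
    localAt p ((J.1 : invertibleRightIdeals O) : Submodule ℤ B) = (α * π ^ m) • localAt p O := by
  have hidx : ((J.1 : invertibleRightIdeals O) : Submodule ℤ B).toAddSubgroup.relIndex I.toAddSubgroup = p ^ (2 * m) :=
    J.relIndex_eq.trans (by rw [hn, ← pow_mul, mul_comm])
  obtain ⟨⟨z, hz, hzeq⟩, hidx'⟩ := localPrincipal_of_subideal hdiv hO hα J.1.2 J.le hidx
  obtain ⟨k, hk, hk'⟩ := exists_relIndex_units_smul_localAt_eq_pow hO z hz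
  rw [hzeq, hk'] at hidx'
  have hkm : k = m := by
    have := Nat.pow_right_injective hp.two_le hidx'
    omega
  have hB := hP.units_smul_localAt_eq_pow_smul hO hp hπ hvπ m z hz (by rw [hk, hkm])
  calc localAt p ((J.1 : invertibleRightIdeals O) : Submodule ℤ B)
      = α • (α⁻¹ • localAt p ((J.1 : invertibleRightIdeals O) : Submodule ℤ B)) := (smul_inv_smul α _).symm
    _ = α • ((π ^ m) • localAt p O) := by rw [hzeq, hB]
    _ = (α * π ^ m) • localAt p O := (mul_smul _ _ _).symm

include hO hP hp hπ hvπ hdiv hα in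
/-- **`Sub(I, p^m)` has at most one element** at a residually ramified prime. [cite: VignerasLNM800, Ch. II §1 Thm. 1.1] -/
theorem subsingleton_subideal (m : ℕ) : Subsingleton (Subideal O I (p ^ m)) := by
  refine ⟨fun J J' => Subideal.ext (eq_iff_forall_prime_localAt_eq.mpr fun q hq => ?_)⟩
  by_cases hqp : q = p
  · subst hqp
    rw [hP.localAt_subideal hO hp hπ hvπ hdiv hα J rfl, hP.localAt_subideal hO hp hπ hvπ hdiv hα J' rfl]
  · have hJ : ((J.1 : invertibleRightIdeals O) : Submodule ℤ B).toAddSubgroup.relIndex I.toAddSubgroup = p ^ (2 * m) :=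
      J.relIndex_eq.trans (by rw [← pow_mul, mul_comm])
    have hJ' : ((J'.1 : invertibleRightIdeals O) : Submodule ℤ B).toAddSubgroup.relIndex I.toAddSubgroup = p ^ (2 * m) :=
      J'.relIndex_eq.trans (by rw [← pow_mul, mul_comm])
    rw [localAt_eq_of_relIndex_eq_prime_pow J.le hJ hp hq hqp, localAt_eq_of_relIndex_eq_prime_pow J'.le hJ' hp hq hqp]

include hO hP hp hπ hvπ hdiv hI hα in
/-- **Existence**: for `K ∈ Sub(I, p^{a+1} p)` there is `M ∈ Sub(I, p^{a+1})` with `K ⊆ M`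
(glue `α π^{a+1} O_(p)` into `I`). [cite: Voight2021, §26.4] -/
theorem exists_subideal_ge {a : ℕ} (K : Subideal O I (p ^ (a + 1) * p)) :
    ∃ M : Subideal O I (p ^ (a + 1)), ((K.1 : invertibleRightIdeals O) : Submodule ℤ B) ≤ ((M.1 : invertibleRightIdeals O) : Submodule ℤ B) := by
  have hπO : (π : B) ∈ localAt p O := by
    have : (π : B) ∈ π • localAt p O := (Submodule.mem_smul_pointwise_iff_exists _ _ _).mpr
      ⟨1, le_localAt p O hO.one_mem, by rw [Units.smul_def, smul_eq_mul, mul_one]⟩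
    rw [← hπ] at this
    exact localAt_mono p hP.le this
  have hπ0 : reducedNorm ℚ B (π : B) ≠ 0 := (isUnit_iff_reducedNorm_ne_zero_holds ℚ B (π : B)).mp π.isUnit
  have hz : ((π ^ (a + 1) : Bˣ) : B) ∈ localAt p O := by
    rw [Units.val_pow_eq_pow_val]; exact hO.pow_mem_localAt hπO _
  obtain ⟨k, hk, hidx⟩ := exists_relIndex_units_smul_localAt_eq_pow hO (π ^ (a + 1)) hz
  have hk' : k = a + 1 := by
    have : padicValRat p (reducedNorm ℚ B ((π ^ (a + 1) : Bˣ) : B)) = ((a + 1 : ℕ) : ℤ) := by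
      rw [Units.val_pow_eq_pow_val, reducedNorm_pow', padicValRat.pow, hvπ, mul_one]
    rw [this] at hk
    exact_mod_cast hk.symm
  rw [hk'] at hidx
  obtain ⟨M, hMinv, hMI, hMidx, hMp, hMq⟩ := exists_subideal_of_localPrincipal hdiv hO hI hα hz hidx
  refine ⟨⟨⟨M, hMinv⟩, hMI, hMidx.trans (by rw [← pow_mul, mul_comm])⟩, ?_⟩
  refine le_iff_forall_prime_localAt_le.mpr fun q hq => ?_
  by_cases hqp : q = p
  · subst hqp
    change localAt q ((K.1 : invertibleRightIdeals O) : Submodule ℤ B) ≤ localAt q M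
    rw [hP.localAt_subideal hO hp hπ hvπ hdiv hα K (show q ^ (a + 1) * q = q ^ (a + 2) by ring), hMp,
      show α * π ^ (a + 2) = (α * π ^ (a + 1)) * π by rw [pow_succ, mul_assoc], mul_smul]
    exact units_smul_mono _ (hO.units_smul_localAt_le hπO)
  · have hK : ((K.1 : invertibleRightIdeals O) : Submodule ℤ B).toAddSubgroup.relIndex I.toAddSubgroup = p ^ (2 * (a + 2)) :=
      K.relIndex_eq.trans (by ring)
    change localAt q ((K.1 : invertibleRightIdeals O) : Submodule ℤ B) ≤ localAt q M
    rw [localAt_eq_of_relIndex_eq_prime_pow K.le hK hp hq hqp, hMq q hq hqp]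

include hO hP hp hπ hvπ hdiv hI hα in
/-- **The fibre count at a residually ramified prime: `1`.** [cite: VignerasLNM800, Ch. III §5 exercice 5.8 (c) (p | D)] -/
theorem card_fibre_eq_one {a : ℕ} (K : Subideal O I (p ^ (a + 1) * p)) :
    Nat.card (Fibre O I (p ^ (a + 1)) ((K.1 : invertibleRightIdeals O) : Submodule ℤ B)) = 1 := by
  obtain ⟨M, hKM⟩ := hP.exists_subideal_ge hO hp hπ hvπ hdiv hI hα K
  haveI := hP.subsingleton_subideal hO hp hπ hvπ hdiv (I := I) hα (a + 1)
  rw [Nat.card_eq_one_iff_exists]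
  exact ⟨⟨M, hKM⟩, fun J => Subtype.ext (Subsingleton.elim _ _)⟩

end IsRamifiedData

/-- **The fibre count at a residually ramified prime**, from `IsResiduallyRamified` alone: every
fibre of `Sub(I, p^{a+1}) → Sub(I, p^{a+1} p)` has exactly one element. [cite: VignerasLNM800, Ch. III §5 exercice 5.8 (c)] -/
theorem IsZOrder.IsResiduallyRamified.card_fibre_eq_one (hdiv : ∀ x : B, x ≠ 0 → IsUnit x) {hO : IsZOrder O}
    (hp : p.Prime) (hram : hO.IsResiduallyRamified p) {I : Submodule ℤ B} (hI : IsInvertibleRightIdeal O I)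
    {a : ℕ} (K : Subideal O I (p ^ (a + 1) * p)) :
    Nat.card (Fibre O I (p ^ (a + 1)) ((K.1 : invertibleRightIdeals O) : Submodule ℤ B)) = 1 := by
  haveI : Fact p.Prime := ⟨hp⟩
  obtain ⟨P, hP⟩ := hram.exists_isRamifiedData
  obtain ⟨π, -, hπ, hvπ⟩ := hP.exists_uniformizer hO hp hdiv
  obtain ⟨α, -, hα⟩ := hI.exists_localAt_eq_units_smul hdiv hO p
  exact hP.card_fibre_eq_one hO hp hπ hvπ hdiv hI hα K

/-- **The fibre count at a residually split prime**, from `IsResiduallySplit` alone. [cite: VignerasLNM800, Ch. III §5 exercice 5.8 (c)] -/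
theorem IsZOrder.IsResiduallySplit.card_fibre (hdiv : ∀ x : B, x ≠ 0 → IsUnit x) {hO : IsZOrder O}
    (hp : p.Prime) (hsplit : hO.IsResiduallySplit p) {I : Submodule ℤ B} (hI : IsInvertibleRightIdeal O I)
    {a : ℕ} (K : Subideal O I (p ^ (a + 1) * p)) :
    (((K.1 : invertibleRightIdeals O) : Submodule ℤ B) ≤ (p : ℤ) • I →
      Nat.card (Fibre O I (p ^ (a + 1)) ((K.1 : invertibleRightIdeals O) : Submodule ℤ B)) = p + 1) ∧
    (¬ ((K.1 : invertibleRightIdeals O) : Submodule ℤ B) ≤ (p : ℤ) • I →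
      Nat.card (Fibre O I (p ^ (a + 1)) ((K.1 : invertibleRightIdeals O) : Submodule ℤ B)) = 1) := by
  obtain ⟨e, u, v, hmu⟩ := hsplit.exists_isMatrixUnitsMod
  exact ⟨fun hK => hmu.card_fibre_of_le hdiv hO hp hI K hK, fun hK => hmu.card_fibre_of_not_le hdiv hO hp hI K hK⟩

end Literature.NumberTheory.Automorphic

end
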